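import Mathlib
import HarnessLib
import Summits.HubbardSuperconductivity.HubbardSuperconductivity.Theorems.KLProgrammeKLRegimeEngineResummationStructure
import Summits.HubbardSuperconductivity.HubbardSuperconductivity.Theorems.KLProgrammeKLRegimeEngineV7Defs

/-!
# Route `KLProgramme` — crux K3, engine child (`KLRegimeEngineV7`/gen-3 `KLRegimeEngineV8`): the resummation-side half of the pair-ladder
# step AT THE REGISTERED ENGINE PACKAGE `klEngGeo / klEngQ P R / klEngU₀ P R c` — the smallness `bhi·D·U² ≤ 1/3` HOLDS for `U ≤ klEngU₀`

Cell gate-hubbard-kl, seat hubbard-kl-k3c1-p2.  `klEngine_resummation_exists` / `klEngine_resummation_structure`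
(`…KLRegimeEngineResummation[Structure]`) produce the implicit-step matrix `N` of (E2-v5)/(E2-v6) from the history's split slot under the
smallness `(Σ w)·D·U² ≤ 1/3`, `D = P.C_W + klLegKappa·Q.CR·P.Klam³`.  Inside the registered skeleton of the engine child (k3c2-p1's
`…Theorems.EngineV7`, package `…KLRegimeEngineV7Defs`: `bhi = 4`, `Q.CR = 2²⁰·r⁴·p⁴` with `p = Klam + C_W + Cd`, `r = 1 + cr + cz + Σ Gfr`,
`klEngU₀ P R c = (2⁴⁰ r⁸ p⁸ (1+c))⁻¹`) that smallness is AUTOMATIC: **`klEng_resummation_smallness`** — `P.WF`, `R.WF`, `0 ≤ c`, `0 ≤ U ≤ klEngU₀ P R c`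
⟹ `klEngGeo.bhi·((P.C_W + klLegKappa·(klEngQ P R).CR·P.Klam³)·U²) ≤ 1/3` (indeed `≤ 1/32`; arithmetic: `D ≤ 2³³ r⁴ p⁷`, `U·2⁴⁰ r⁸ p⁸ ≤ 1`).
Hence the package forms **`klEng_resummation_exists`** / **`klEng_resummation_structure`**: for the `stub_engine_step` binders (`U ≤ klEngU₀ P R c`)
and any scale-`n` bubble weights `w ≥ 0` of mass `≤ klEngGeo.bhi`, the split slot `PairArrayAtV2 … (klEngQ P R) … m` of the history gives `N` with
`(1 + diag w · klPairArray … m Qm)·N = 1`, `|(𝒞N)(k,k')| ≤ 6(2|U| + D U²)` and `|(𝒞N)(k,k') − cascadeStep W u| ≤ 12·D·U²` on the ball.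
Everything is proved; no definitions.
-/

noncomputable section

namespace Summit.HubbardSuperconductivity.HubbardSuperconductivity.Theorems.KLRegimeSplit

set_option linter.dupNamespace false -- summit = problem name (single-conjunct summit), D-0017

open Finset Matrix Literature.MathematicalPhysics.QuantumLattice Literature.Probability.LatticeModels
open Summit.HubbardSuperconductivity.HubbardSuperconductivity.Theorems.CooperChannelRiccatiFlow
open Summit.HubbardSuperconductivity.HubbardSuperconductivity.Theorems.EngineV7

/-- **The resummation smallness holds at the engine package**: for `U ≤ klEngU₀ P R c`,
`klEngGeo.bhi·((P.C_W + klLegKappa·(klEngQ P R).CR·P.Klam³)·U²) ≤ 1/3`. -/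
theorem klEng_resummation_smallness {P : SplitConsts} {R : RenConsts} (hP : P.WF) (hR : R.WF) {c U : ℝ} (hc : 0 ≤ c)
    (hU : 0 ≤ U) (hUle : U ≤ klEngU₀ P R c) :
    klEngGeo.bhi * ((P.C_W + klLegKappa * (klEngQ P R).CR * P.Klam ^ 3) * U ^ 2) ≤ 1 / 3 := by
  set p : ℝ := klEngP P with hp_def
  set r : ℝ := klEngR R with hr_def
  have hp1 : 1 ≤ p := one_le_klEngP hP
  have hr1 : 1 ≤ r := one_le_klEngR hR
  have hp0 : 0 ≤ p := zero_le_one.trans hp1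
  have hr0 : 0 ≤ r := zero_le_one.trans hr1
  have hK0 : 0 ≤ P.Klam := zero_le_one.trans hP.1
  have hKp : P.Klam ≤ p := by rw [hp_def]; unfold klEngP; linarith [hP.2.1, hP.2.2]
  have hCWp : P.C_W ≤ p := by rw [hp_def]; unfold klEngP; linarith [hP.1, hP.2.2]
  have hbhi : klEngGeo.bhi = 4 := rfl
  have hCR : (klEngQ P R).CR = 2 ^ 20 * r ^ 4 * p ^ 4 := rfl
  have hκ : klLegKappa = 4000 := rfl
  -- `D ≤ 2^33 r⁴ p⁷`
  have hr4 : 1 ≤ r ^ 4 := one_le_pow₀ hr1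
  have hp7 : p ≤ p ^ 7 := by
    calc p = p ^ 1 := (pow_one p).symm
      _ ≤ p ^ 7 := pow_le_pow_right₀ hp1 (by norm_num)
  have hD : P.C_W + klLegKappa * (klEngQ P R).CR * P.Klam ^ 3 ≤ 2 ^ 33 * r ^ 4 * p ^ 7 := by
    rw [hCR, hκ]
    have h1 : P.Klam ^ 3 ≤ p ^ 3 := pow_le_pow_left₀ hK0 hKp 3
    have h2 : 4000 * (2 ^ 20 * r ^ 4 * p ^ 4) * P.Klam ^ 3 ≤ 4000 * (2 ^ 20 * r ^ 4 * p ^ 4) * p ^ 3 :=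
      mul_le_mul_of_nonneg_left h1 (by positivity)
    have h3 : p ≤ 2 ^ 32 * r ^ 4 * p ^ 7 := by
      calc p = 1 * 1 * p := by ring
        _ ≤ 2 ^ 32 * r ^ 4 * p ^ 7 := by gcongr; norm_num
    have h4 : 4000 * (2 ^ 20 * r ^ 4 * p ^ 4) * p ^ 3 ≤ 2 ^ 32 * r ^ 4 * p ^ 7 := by
      have : 4000 * (2 ^ 20 * r ^ 4 * p ^ 4) * p ^ 3 = 4000 * 2 ^ 20 * (r ^ 4 * p ^ 7) := by ring
      rw [this, show (2 : ℝ) ^ 32 * r ^ 4 * p ^ 7 = 2 ^ 32 * (r ^ 4 * p ^ 7) by ring]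
      exact mul_le_mul_of_nonneg_right (by norm_num) (by positivity)
    calc P.C_W + 4000 * (2 ^ 20 * r ^ 4 * p ^ 4) * P.Klam ^ 3 ≤ p + 4000 * (2 ^ 20 * r ^ 4 * p ^ 4) * p ^ 3 := by linarith
      _ ≤ 2 ^ 32 * r ^ 4 * p ^ 7 + 2 ^ 32 * r ^ 4 * p ^ 7 := by linarith
      _ = 2 ^ 33 * r ^ 4 * p ^ 7 := by ring
  -- `U · 2^40 r⁸ p⁸ ≤ 1`
  have hA0 : 0 < 2 ^ 40 * r ^ 8 * p ^ 8 * (1 + c) := by positivity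
  have hUA : U * (2 ^ 40 * r ^ 8 * p ^ 8 * (1 + c)) ≤ 1 := by
    have h := mul_le_mul_of_nonneg_right hUle hA0.le
    unfold klEngU₀ at h
    rw [← hp_def, ← hr_def, inv_mul_cancel₀ hA0.ne'] at h
    exact h
  have hUA' : U * (2 ^ 40 * r ^ 8 * p ^ 8) ≤ 1 := by
    have : U * (2 ^ 40 * r ^ 8 * p ^ 8) ≤ U * (2 ^ 40 * r ^ 8 * p ^ 8 * (1 + c)) := by
      have h0 : 0 ≤ U * (2 ^ 40 * r ^ 8 * p ^ 8) := by positivity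
      nlinarith
    exact this.trans hUA
  have hU1 : U ≤ 1 := by
    have hr8 : (1 : ℝ) ≤ r ^ 8 := one_le_pow₀ hr1
    have hp8 : (1 : ℝ) ≤ p ^ 8 := one_le_pow₀ hp1
    have h1 : (1 : ℝ) ≤ 2 ^ 40 * r ^ 8 * p ^ 8 :=
      one_le_mul_of_one_le_of_one_le (one_le_mul_of_one_le_of_one_le (by norm_num) hr8) hp8
    nlinarith
  -- `2^35 r⁴ p⁷ U ≤ 1/32`
  have hmono : r ^ 4 * p ^ 7 ≤ r ^ 8 * p ^ 8 :=
    mul_le_mul (pow_le_pow_right₀ hr1 (by norm_num)) (pow_le_pow_right₀ hp1 (by norm_num)) (by positivity) (by positivity)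
  have h32 : 2 ^ 35 * r ^ 4 * p ^ 7 * U ≤ 1 / 32 := by
    have h1 : 2 ^ 40 * (r ^ 4 * p ^ 7) * U ≤ 2 ^ 40 * (r ^ 8 * p ^ 8) * U :=
      mul_le_mul_of_nonneg_right (mul_le_mul_of_nonneg_left hmono (by norm_num)) hU
    have h2 : 2 ^ 40 * (r ^ 8 * p ^ 8) * U ≤ 1 := by linarith
    linarith
  -- conclusion
  rw [hbhi]
  have hU2 : 0 ≤ U ^ 2 := sq_nonneg U
  calc 4 * ((P.C_W + klLegKappa * (klEngQ P R).CR * P.Klam ^ 3) * U ^ 2) ≤ 4 * ((2 ^ 33 * r ^ 4 * p ^ 7) * U ^ 2) := by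
        gcongr
    _ = (2 ^ 35 * r ^ 4 * p ^ 7 * U) * U := by ring
    _ ≤ (1 / 32) * 1 := mul_le_mul h32 hU1 hU (by norm_num)
    _ ≤ 1 / 3 := by norm_num

section Model

variable (L M : ℕ) [NeZero L] [NeZero M]

/-- **(E2) resummation side at the engine package, ENTRY form**: for the `stub_engine_step` binders and any scale weights `w ≥ 0` of mass
`≤ klEngGeo.bhi`, the split slot `PairArrayAtV2 … (klEngQ P R) … m` gives `N` with `(1 + diag w·𝒞_m)·N = 1` and
`|(𝒞_m N)(k,k')| ≤ 6·(2|U| + D·U²)` on the ball, `D = P.C_W + klLegKappa·(klEngQ P R).CR·P.Klam³`. -/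
theorem klEng_resummation_exists {P : SplitConsts} {R : RenConsts} (hP : P.WF) (hR : R.WF) {c β U μ : ℝ} {K : TrigPolyC4v} {m : ℕ}
    (hc : 0 ≤ c) (hU : 0 ≤ U) (hUle : U ≤ klEngU₀ P R c) (hsplit : PairArrayAtV2 L M P (klEngQ P R) β U μ K m)
    (w : TorusSite 2 L → ℝ) (hw : ∀ q, 0 ≤ w q) (hwsum : ∑ q, w q ≤ klEngGeo.bhi) (Qm : TorusSite 2 L) :
    ∃ N : Matrix (TorusSite 2 L) (TorusSite 2 L) ℂ,
      (1 + Matrix.diagonal (fun q => (w q : ℂ)) * klPairArray L M β U μ K m Qm) * N = 1 ∧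
      ∀ k ∈ klBall L μ K, ∀ k' ∈ klBall L μ K,
        ‖(klPairArray L M β U μ K m Qm * N) k k'‖ ≤
          6 * (2 * |U| + (P.C_W + klLegKappa * (klEngQ P R).CR * P.Klam ^ 3) * U ^ 2) := by
  have hD : 0 ≤ P.C_W + klLegKappa * (klEngQ P R).CR * P.Klam ^ 3 := by
    have hκ : 0 ≤ klLegKappa := by unfold klLegKappa; norm_num
    have := hP.2.1; have := (klEngQ_wf P R).2.1; have := zero_le_one.trans hP.1
    positivity
  refine klEngine_resummation_exists L M hsplit w hw ?_ hD Qm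
  have hsm := klEng_resummation_smallness hP hR hc hU hUle
  have h0 : 0 ≤ (P.C_W + klLegKappa * (klEngQ P R).CR * P.Klam ^ 3) * U ^ 2 := mul_nonneg hD (sq_nonneg U)
  exact (mul_le_mul_of_nonneg_right hwsum h0).trans hsm

/-- **(E2) resummation side at the engine package, STRUCTURE form**: same data ⟹ the split's own constant `u ∈ [0, 2|U|]`, its one-step cascade
`cascadeStep W u ∈ [0, u]` (`W = Σ_{ball} w`), and `N` with `(1 + diag w·𝒞_m)·N = 1` and `|(𝒞_m N)(k,k') − cascadeStep W u| ≤ 12·D·U²`. -/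
theorem klEng_resummation_structure {P : SplitConsts} {R : RenConsts} (hP : P.WF) (hR : R.WF) {c β U μ : ℝ} {K : TrigPolyC4v}
    {m : ℕ} (hc : 0 ≤ c) (hU : 0 ≤ U) (hUle : U ≤ klEngU₀ P R c) (hsplit : PairArrayAtV2 L M P (klEngQ P R) β U μ K m)
    (w : TorusSite 2 L → ℝ) (hw : ∀ q, 0 ≤ w q) (hwsum : ∑ q, w q ≤ klEngGeo.bhi) (Qm : TorusSite 2 L) :
    ∃ u : ℝ, 0 ≤ u ∧ u ≤ 2 * |U| ∧ 0 ≤ cascadeStep (∑ q ∈ klBall L μ K, w q) u ∧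
      cascadeStep (∑ q ∈ klBall L μ K, w q) u ≤ u ∧
      ∃ N : Matrix (TorusSite 2 L) (TorusSite 2 L) ℂ,
        (1 + Matrix.diagonal (fun q => (w q : ℂ)) * klPairArray L M β U μ K m Qm) * N = 1 ∧
        ∀ k ∈ klBall L μ K, ∀ k' ∈ klBall L μ K,
          ‖(klPairArray L M β U μ K m Qm * N) k k' - (cascadeStep (∑ q ∈ klBall L μ K, w q) u : ℝ)‖ ≤
            12 * ((P.C_W + klLegKappa * (klEngQ P R).CR * P.Klam ^ 3) * U ^ 2) := by
  have hD : 0 ≤ P.C_W + klLegKappa * (klEngQ P R).CR * P.Klam ^ 3 := by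
    have hκ : 0 ≤ klLegKappa := by unfold klLegKappa; norm_num
    have := hP.2.1; have := (klEngQ_wf P R).2.1; have := zero_le_one.trans hP.1
    positivity
  refine klEngine_resummation_structure L M hsplit w hw ?_ hD Qm
  have hsm := klEng_resummation_smallness hP hR hc hU hUle
  have h0 : 0 ≤ (P.C_W + klLegKappa * (klEngQ P R).CR * P.Klam ^ 3) * U ^ 2 := mul_nonneg hD (sq_nonneg U)
  exact (mul_le_mul_of_nonneg_right hwsum h0).trans hsm

end Model

end Summit.HubbardSuperconductivity.HubbardSuperconductivity.Theorems.KLRegimeSplit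

end
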